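import Summits.ResolutionOfSingularities.KangarooAtlas.MizutaniEdgeDatumBound
import HarnessLib

/-!
# Mizutani's extremal scheme `H_e` is a hypersurface: `B_{P,H_e} = V(Σ_i a⁰_i X_i^{p^e})` (Example 2.1, all `e`)

Cell `pub-rosobs`, Mizutani enclosure (seat mizutani-encloser-2, gen 6). AI-written; AI review is weaker than expert
review; NOT a resolution-of-singularities theorem (summit relevance C).

Mizutani 1973, Example 2.1 (after Oda) gives, for a `p`-independent pair `c_1, c_2 ∈ k`, the pair `(V, W)` with
`W = ⊕_i k^p X_i ⊕ k^p Z_i` (`i = 0, …, p − 1`) and `V = k·f`, `f = Σ_i c_1^i (X_i + c_2 Z_i)`, and ends with the sentence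
«The H-scheme corresponding to this pair is `Spec(k[x_i, z_i] / (Σ_{i=0}^{p−1} c_1^i (x_i^p + c_2 z_i^p)))`» — a HYPERSURFACE of
the vector group `𝔸^{2p}`, of dimension `2p − 1`, exponent `1`.  The tree's attained point `GenAtt.attP k p e u` of `ℙ^{2q−1}_k`
(`q = p^e`, coordinates indexed by `(ε, j) ∈ {0,1} × [0, q)`, `MizutaniAttainedGeneralPoint.lean`) with its invariant additive form
`a⁰ = attA0 k p e u` (`a⁰_{(0,j)} = u_0 u_1^{q−1−j}`, `a⁰_{(1,j)} = −u_1^{q−1−j}`, `MizutaniAttainedGeneralForms.lean`) is, for `e = 1`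
and `(c_1, c_2) = (u_1, −u_0)`, `X_i = x_{(1, p−1−i)}`, `Z_i = x_{(0, p−1−i)}`, exactly Mizutani's example up to the overall sign of `f`
(`−a⁰ = Σ_i u_1^{i} (x_{(1,p−1−i)} − u_0 x_{(0,p−1−i)})`); for general `e` it is the scheme `H_e` of Remark 2.10.

This file proves the last sentence of Example 2.1 for every `e ≥ 1` and every field `k` with a `p`-independent pair `u`:

* **`bIdeal_attP_eq_span_addForm_attA0`** — `U_+(H_e)S = (Σ_i a⁰_i X_i^{p^e})`: the ideal of `B_{P,attP}` is principal, generated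
  by the additive form of `a⁰`; equivalently `B_{P,H_e} = V(Σ_j u_1^{q−1−j}(u_0 x_{(0,j)}^q − x_{(1,j)}^q)) ⊂ 𝔸^{2q}`;
* `triangularPresentation_attP_r` — every triangular presentation of `U(H_e)` has exactly ONE generator (`r = 1`), of exponent `e`
  (`triangularPresentation_attP_expo`): `U(H_e) = k[σ]` with `σ` a `k^×`-multiple of `Σ_i a⁰_i X_i^{p^e}`
  (`triangularPresentation_attP_gen`);
* `multAlgebra_attP_eq_adjoin` — `U(H_e) = k[Σ_i a⁰_i X_i^{p^e}]`.

Proof: `dim B_{P,attP} + 1 = 2q` (`mizutani_attained_hironaka`) and `dim = 2q − r` (`ringKrullDim_quotient_bIdeal_eq_sub_r`) give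
`r = 1`; the generator's exponent is `exponent = e` (`exponent_eq_sup_expo`, `exponent_attP`); its coefficient vector lies in
`(U ∩ L)_e = (L_B)_e = k·a⁰` (`coef_mem_hirForms`, `hirForms_eq_invForms`, `finrank_invForms_attP`, `attA0_mem_invForms`); and
`U_+S = (σ_1, …, σ_r)` (`bIdeal_eq_span_range_gen`).

## References

* H. Mizutani, *Hironaka's additive group schemes*, Nagoya Math. J. 52 (1973) 85–95, Example 2.1, Remark 2.10.
  [Mizutani1973HironakaGroupSchemes]
-/

noncomputable section

open MvPolynomial Literature.AlgebraicGeometry.Resolution Literature.AlgebraicGeometry.Resolution.HironakaScheme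
open Literature.AlgebraicGeometry.Hironaka2017.EdgeAlgebra

namespace Summit.ResolutionOfSingularities.KangarooAtlas.Mizutani

universe u

section Hypersurface

variable {k : Type u} [Field k] {p e : ℕ} [hp : Fact p.Prime] [CharP k p] {u : Fin 2 → k}

/-- **`r = 1` for `H_e`**: every triangular presentation `U(H_e) = k[σ_1, …, σ_r]` of the invariant algebra of Mizutani's point
`attP k p e u` (`u` a `p`-independent pair, `e ≥ 1`) has exactly one generator.
[cite: Mizutani1973HironakaGroupSchemes, Example 2.1 (the H-scheme of the pair is a hypersurface of the 2p-dimensional vector group)] -/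
theorem triangularPresentation_attP_r (hu : PIndep p 1 u) (he : 1 ≤ e) [(GenAtt.attP k p e u).IsPrime]
    (P : TriangularPresentation p (multAlgebra k (GenAtt.attP k p e u))) : P.r = 1 := by
  have hP : IsPoint k (GenAtt.attP k p e u) := GenAtt.isPoint_attP fun l => GenAtt.ne_zero_of_pIndep hu l
  obtain ⟨-, hdim⟩ := mizutani_attained_hironaka hu he
  rw [ringKrullDim_quotient_bIdeal_eq_sub_r k p _ hP P] at hdim
  have h1 : (attN p e + 1 - P.r) + 1 = 2 * p ^ e := by exact_mod_cast hdim
  have h2 := attN_succ p e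
  have h3 := P.r_le
  omega

/-- For `H_e`, every index of a triangular presentation is the unique index `⟨0, _⟩`. [folklore] -/
theorem triangularPresentation_attP_eq_zero (hu : PIndep p 1 u) (he : 1 ≤ e) [(GenAtt.attP k p e u).IsPrime]
    (P : TriangularPresentation p (multAlgebra k (GenAtt.attP k p e u))) (j : Fin P.r) :
    j = ⟨0, by rw [triangularPresentation_attP_r hu he P]; exact Nat.one_pos⟩ := by
  have hr := triangularPresentation_attP_r hu he P
  ext
  have := j.isLt
  simp only
  omega

/-- **The unique generator of `U(H_e)` has exponent `e`** (`q_1 = p^e`). [cite: Mizutani1973HironakaGroupSchemes, Remark 2.10 (e(H_e) = e)] -/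
theorem triangularPresentation_attP_expo (hu : PIndep p 1 u) (he : 1 ≤ e) [(GenAtt.attP k p e u).IsPrime]
    (P : TriangularPresentation p (multAlgebra k (GenAtt.attP k p e u))) (j : Fin P.r) : P.expo j = e := by
  classical
  have hexp : exponent k p (GenAtt.attP k p e u) = e := GenAtt.exponent_attP hu he
  have hsup : Finset.univ.sup P.expo = e := by rw [← exponent_eq_sup_expo k p _ P, hexp]
  refine le_antisymm ((Finset.le_sup (Finset.mem_univ j)).trans hsup.le) ?_
  have h : Finset.univ.sup P.expo ≤ P.expo j := by
    refine Finset.sup_le fun i _ => ?_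
    rw [triangularPresentation_attP_eq_zero hu he P i, triangularPresentation_attP_eq_zero hu he P j]
  rwa [hsup] at h

/-- `(L_B)_e(H_e) = k · a⁰`. [cite: Mizutani1973HironakaGroupSchemes, Remark 2.10 (the invariant forms of H_e)] -/
theorem invForms_attP_eq_span_attA0 (hu : PIndep p 1 u) (he : 1 ≤ e) :
    invForms k p (GenAtt.attP k p e u) e = Submodule.span k {GenAtt.attA0 k p e u} := by
  have hle : Submodule.span k {GenAtt.attA0 k p e u} ≤ invForms k p (GenAtt.attP k p e u) e := by
    rw [Submodule.span_le, Set.singleton_subset_iff]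
    exact GenAtt.attA0_mem_invForms
  haveI : FiniteDimensional k (invForms k p (GenAtt.attP k p e u) e) :=
    Module.finite_of_finrank_eq_succ (GenAtt.finrank_invForms_attP hu he)
  refine (Submodule.eq_of_le_of_finrank_eq hle ?_).symm
  rw [finrank_span_singleton GenAtt.attA0_ne_zero, GenAtt.finrank_invForms_attP hu he]

/-- **The generator of `U(H_e)` is a unit multiple of `Σ_i a⁰_i X_i^{p^e}`**: for every triangular presentation and every index `j`,
`σ_j = C c · addForm e a⁰` with `c ≠ 0`. [cite: Mizutani1973HironakaGroupSchemes, Example 2.1] -/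
theorem triangularPresentation_attP_gen (hu : PIndep p 1 u) (he : 1 ≤ e) [(GenAtt.attP k p e u).IsPrime]
    (P : TriangularPresentation p (multAlgebra k (GenAtt.attP k p e u))) (j : Fin P.r) :
    ∃ c : k, c ≠ 0 ∧ P.gen j = C c * addForm k p e (GenAtt.attA0 k p e u) := by
  have hcoef : P.coef j ∈ invForms k p (GenAtt.attP k p e u) e := by
    have h := coef_mem_hirForms k p _ P j
    rw [triangularPresentation_attP_expo hu he P j] at h
    rwa [← hirForms_eq_invForms (GenAtt.attP k p e u) e]
  rw [invForms_attP_eq_span_attA0 hu he, Submodule.mem_span_singleton] at hcoef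
  obtain ⟨c, hc⟩ := hcoef
  refine ⟨c, ?_, ?_⟩
  · rintro rfl
    have h1 := P.coef_pivot j
    rw [← hc, zero_smul, Pi.zero_apply] at h1
    exact zero_ne_one h1
  · rw [gen_eq_addForm, triangularPresentation_attP_expo hu he P j, ← hc, addForm_smul]

/-- **`B_{P,H_e}` IS A HYPERSURFACE: `U_+(H_e)S = (Σ_i a⁰_i X_i^{p^e})`.**  For every field `k` of characteristic `p`, every
`p`-independent pair `u = (u_0, u_1)` and every `e ≥ 1`, the ideal of Mizutani's extremal scheme `B_{P,attP} ⊂ 𝔸^{2q}` (`q = p^e`) is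
generated by the single additive form `Σ_{ε,j} a⁰_{(ε,j)} x_{(ε,j)}^q = Σ_j u_1^{q−1−j}(u_0 x_{(0,j)}^q − x_{(1,j)}^q)` — Mizutani's
«`Spec(k[x_i, z_i]/(Σ_i c_1^i (x_i^p + c_2 z_i^p)))`» (Example 2.1, `e = 1`, `(c_1, c_2) = (u_1, −u_0)` up to the sign of the form and
the indexing `X_i = x_{(1,p−1−i)}`, `Z_i = x_{(0,p−1−i)}`), and the scheme `H_e` of Remark 2.10 for general `e`.
[cite: Mizutani1973HironakaGroupSchemes, Example 2.1 and Remark 2.10] -/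
theorem bIdeal_attP_eq_span_addForm_attA0 (hu : PIndep p 1 u) (he : 1 ≤ e) :
    bIdeal k (GenAtt.attP k p e u) = Ideal.span {addForm k p e (GenAtt.attA0 k p e u)} := by
  have hP : IsPoint k (GenAtt.attP k p e u) := GenAtt.isPoint_attP fun l => GenAtt.ne_zero_of_pIndep hu l
  haveI : (GenAtt.attP k p e u).IsPrime := hP.1
  obtain ⟨P⟩ := nonempty_triangularPresentation_multAlgebra k p (GenAtt.attP k p e u) hP
  set j₀ : Fin P.r := ⟨0, by rw [triangularPresentation_attP_r hu he P]; exact Nat.one_pos⟩ with hj₀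
  obtain ⟨c, hc, hgen⟩ := triangularPresentation_attP_gen hu he P j₀
  have hrange : Set.range P.gen = {P.gen j₀} := by
    ext f
    simp only [Set.mem_range, Set.mem_singleton_iff]
    constructor
    · rintro ⟨j, rfl⟩
      rw [triangularPresentation_attP_eq_zero hu he P j]
    · rintro rfl
      exact ⟨j₀, rfl⟩
  rw [bIdeal_eq_span_range_gen k p _ P, hrange, hgen]
  exact Ideal.span_singleton_mul_left_unit (IsUnit.map C (Ne.isUnit hc)) _

/-- **`U(H_e) = k[Σ_i a⁰_i X_i^{p^e}]`**: the invariant algebra of Mizutani's point is generated by the single additive form of `a⁰`.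
[cite: Mizutani1973HironakaGroupSchemes, Example 2.1 and Remark 2.10] -/
theorem multAlgebra_attP_eq_adjoin (hu : PIndep p 1 u) (he : 1 ≤ e) :
    multAlgebra k (GenAtt.attP k p e u) = Algebra.adjoin k {addForm k p e (GenAtt.attA0 k p e u)} := by
  have hP : IsPoint k (GenAtt.attP k p e u) := GenAtt.isPoint_attP fun l => GenAtt.ne_zero_of_pIndep hu l
  haveI : (GenAtt.attP k p e u).IsPrime := hP.1
  obtain ⟨P⟩ := nonempty_triangularPresentation_multAlgebra k p (GenAtt.attP k p e u) hP
  set j₀ : Fin P.r := ⟨0, by rw [triangularPresentation_attP_r hu he P]; exact Nat.one_pos⟩ with hj₀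
  obtain ⟨c, hc, hgen⟩ := triangularPresentation_attP_gen hu he P j₀
  have hrange : Set.range P.gen = {P.gen j₀} := by
    ext f
    simp only [Set.mem_range, Set.mem_singleton_iff]
    constructor
    · rintro ⟨j, rfl⟩
      rw [triangularPresentation_attP_eq_zero hu he P j]
    · rintro rfl
      exact ⟨j₀, rfl⟩
  have hadj : multAlgebra k (GenAtt.attP k p e u) = Algebra.adjoin k (Set.range P.gen) := P.eq_adjoin
  rw [hadj, hrange, hgen]
  apply le_antisymm
  · refine Algebra.adjoin_le ?_
    rw [Set.singleton_subset_iff]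
    exact Subalgebra.mul_mem _ (Subalgebra.algebraMap_mem _ c) (Algebra.subset_adjoin (Set.mem_singleton _))
  · refine Algebra.adjoin_le ?_
    rw [Set.singleton_subset_iff]
    have hmem : C c * addForm k p e (GenAtt.attA0 k p e u) ∈
        Algebra.adjoin k {C c * addForm k p e (GenAtt.attA0 k p e u)} := Algebra.subset_adjoin (Set.mem_singleton _)
    have h := Subalgebra.mul_mem _ (Subalgebra.algebraMap_mem _ c⁻¹) hmem
    rwa [MvPolynomial.algebraMap_eq, ← mul_assoc, ← map_mul, inv_mul_cancel₀ hc, map_one, one_mul] at h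

/-- **The dimension count of Example 2.1, read on the hypersurface**: `dim B_{P,H_e} = 2q − 1` and the exponent is `e` — restated next
to the hypersurface description for the reader (`mizutani_attained_hironaka`). [cite: Mizutani1973HironakaGroupSchemes, Example 2.1 ("e(H) = 1 and dim H = 2p − 1") and Remark 2.10] -/
theorem exponent_attP_and_ringKrullDim (hu : PIndep p 1 u) (he : 1 ≤ e) :
    exponent k p (GenAtt.attP k p e u) = e ∧
      ringKrullDim (MvPolynomial (Fin (attN p e + 1)) k ⧸
        Ideal.span {addForm k p e (GenAtt.attA0 k p e u)}) + 1 = (2 * p ^ e : WithBot ℕ∞) := by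
  rw [← bIdeal_attP_eq_span_addForm_attA0 hu he]
  exact mizutani_attained_hironaka hu he

end Hypersurface

end Summit.ResolutionOfSingularities.KangarooAtlas.Mizutani

end
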